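import Literature.AlgebraicGeometry.Motives.CorrespondenceAlgebraModNumericalSemisimple
import Literature.AlgebraicGeometry.Motives.StandardConjecturesKunnethProofs
import Literature.AlgebraicGeometry.Motives.StandardConjecturesAbelianVarietyProofs
import Literature.LinearAlgebra.Matrix.CommutatorNilpotent
import Mathlib.RingTheory.Nilpotent.Lemmas
import HarnessLib

/-!
# Jannsen's Corollary 1: under algebraicity of the Künneth projectors, numerically trivial
# correspondences are nilpotent and form the Jacobson radical (Jannsen 1992, Cor. 1)

Topic `Literature/AlgebraicGeometry/Motives`, namespace
`Literature.AlgebraicGeometry.Motives.WeilCohomology`; sequel of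
`Motives/CorrespondenceAlgebraModNumericalSemisimple` (the `K`-algebra `Bⁿ(X × X)_K =
W.homCorrAlgebra n X` of homological correspondences of degree `0`, its graded trace
`W.gradedTrace n X` and the two-sided ideal `W.numericallyTrivial n X` = the kernel of Jannsen's
`S : B → A = A^{dim X}_num(X × X)`).

Source read on the page: U. Jannsen, *Motives, numerical equivalence, and semi-simplicity*,
Invent. Math. **107** (1992) [Jannsen1992Motives], held text `paper:doi-10-1007-bf01231898`,
pp. 449–450: "**Corollary 1.** Denote by `A_num(-)` the cycle groups modulo numerical equivalence
and by `A_hom(-)` those modulo homological equivalence — with respect to some fixed Weil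
cohomology `X ↦ H(X)`. If for a variety `X`, the Künneth components `π^j` […] of the diagonal are
algebraic (cf. [K1] Sect. 2), then the kernel of the surjective ring homomorphism
`S : B = A^{dim(X)}_hom(X × X) → A^{dim(X)}_num(X × X) = A` is the Jacobson radical of `B`, and is
a nilpotent ideal. *Proof* By the proof of c) ⇒ b) of Theorem 1, the radical `J'` of `B` is
contained in the kernel of `S`. Now, by definition of the `π^j` we have `Tr_i(f ∘ π^j) = δ_ij Tr_i(f)`
for every `f ∈ B` […]. If `f` is numerically equivalent to zero, and if the `π^j` are algebraic,
then the above formula and Lemma 1 show that `Tr_i(f) = 0` for all `i ≥ 0`. The same is true for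
all powers of `f`, which implies that for all `i ≥ 0` the endomorphism `f_i` of `H^i(X)` induced
by `f` has zero eigenvalues, thus is nilpotent. By definition, the cycle map
`B → H^{2dim(X)}(X × X) = ⊕_{i≥0} End H^i(X)` is an injective ring homomorphism, so that `f` is
nilpotent in `B`. […] First consider the case `F = Λ`. Then `B` is a finite-dimensional
`Λ`-algebra, and the fact that every element in `Ker S` is nilpotent implies that `Ker S` is a
nilpotent ideal and contained in the radical."; p. 451, Remark 1: "The assumption of Corollary 1
is fulfilled if `dim X ≤ 2` ([M]) or if `X` is an abelian variety (by results of Lieberman, cf.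
[K] Sect. 2 appendix), and for all `X` if `k` is (contained in the algebraic closure of) a finite
field ([KM])."

## Lean rendering and what is proved (coefficients `F = Λ = K`, the case treated first in print)

The Künneth projector `π^i` as an element of `Π_j End_K Hʲ(X)` is `Pi.single i 1` (the identity
on `Hⁱ(X)`, zero elsewhere). Its algebraicity is the tree's `W.StandardConjectureC n X`
(`Motives/Correspondences`: each degree projector is induced by an algebraic correspondence with
`ℚ`-coefficients; `standardConjectureC_iff`: `⇔ ∀ i, W.IsAlgebraicOperator n n (id : Hⁱ(X) → Hⁱ(X))`).

* `isHomCorrespondence_single_iff_isAlgebraicOperator` — for `T : Hⁱ(X) → Hⁱ(X)`, the single-degree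
  operator `Pi.single i T` is a homological correspondence iff `T` is an algebraic operator in the
  sense of `Motives/PreWeilCohomology`; hence `standardConjectureC_iff_forall_isHomCorrespondence_single`:
  **`C(X)` ⇔ all Künneth projectors lie in `Bⁿ(X × X)_K`**.
* `gradedTrace_single_mul` — "`Tr_i(f ∘ π^j) = δ_ij Tr_i(f)`": `Σ_l (-1)^l Tr_l(π^i ∘ f) = (-1)^i Tr(f_i)`.
* `trace_pow_eq_zero_of_mem_numericallyTrivial` — under `C(X)`, a numerically trivial `f` has
  `Tr((f_i)^j) = 0` for all `i` and `j ≥ 1` ("the same is true for all powers of `f`").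
* **`isNilpotent_of_mem_numericallyTrivial`** — under `C(X)`, every numerically trivial
  correspondence is NILPOTENT (each `f_i` is nilpotent by the trace criterion in characteristic
  `0`, the tree's `Literature.LinearAlgebra.Matrix.isNilpotent_of_forall_trace_pow_eq_zero`; the
  cycle map into `⊕ End Hⁱ(X)` is injective).
* **`numericallyTrivial_eq_jacobson`** — COROLLARY 1: under `C(X)`, `Ker S` IS the Jacobson
  radical `J'` of `Bⁿ(X × X)_K`; **`isNilpotent_numericallyTrivial`** — and it is a nilpotent ideal.
* `mem_jacobson_iff_forall_gradedTrace_eq_zero`, `mem_numericallyTrivial_iff_forall_isNilpotent` —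
  under `C(X)`, membership in `J'` is numerical triviality, and numerical triviality of `f` is
  nilpotency of all `g ∘ f ∘ h`; `numericallyTrivial_eq_jacobson_of_standardConjectureB`,
  `numericallyTrivial_eq_jacobson_abelianVariety` — Remark 1 via `B(X) ⇒ C(X)` and Lieberman.

Not here: the case `F ⊊ Λ` of the corollary (Jannsen's commutative diagram, needing the
`F`-structure `A_hom(-, F)`), and Remark 1's instances beyond what the tree's discharged facts give
directly (recorded as the corollary `numericallyTrivial_eq_jacobson_of_standardConjectureB`:
`B(X)` ⇒ `C(X)`, the tree's `standardConjectureC_of_standardConjectureB_holds`).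

## References

* [Jannsen1992Motives] U. Jannsen, Invent. Math. 107 (1992) 447–452 — Cor. 1 and proof
  (pp. 449–450), Remark 1 (p. 451).
* [Kleiman1968AlgebraicCycles] S. Kleiman, *Algebraic cycles and the Weil conjectures* (1968) —
  §2 (Künneth projectors `πⁱ`, conjecture `C(X)`), Prop. 1.3.6.
* [HornJohnson2013] R. Horn, C. Johnson, *Matrix Analysis* (2013) — 2.4.P10 (`A` nilpotent iff
  `tr A^k = 0`, `k = 1, …, n`), through the tree's `LinearAlgebra/Matrix/CommutatorNilpotent`.

## Provenance

Lane `lit-hodgefound` (summit `HodgeConjecture`, Track 2 foundations library, Layer B: motives),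
seat `lit-hodgefound-p29` (literature-prover, generation 34, row g34-#3).
-/

universe u v

open CategoryTheory AlgebraicGeometry MonoidalCategory CartesianMonoidalCategory
open scoped TensorProduct

noncomputable section

namespace Literature.AlgebraicGeometry.Motives

namespace WeilCohomology

variable {k : Type u} [Field k] {K : Type v} [Field K] [CharZero K] (W : WeilCohomology k K)
variable {n : ℕ} {X : SchemeOver k}

/-! ## Künneth projectors as elements of `Bⁿ(X × X)_K` -/

section Single

/-- **A single-degree operator `Pi.single i T` (`T` on `Hⁱ(X)`, zero in the other degrees) is a
homological correspondence iff `T : Hⁱ(X) → Hⁱ(X)` is an algebraic operator** in the sense of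
`Motives/PreWeilCohomology` (`W.IsAlgebraicOperator n n T`: the graded operator with the single
component `T` is induced by rational algebraic classes): both say that some `u ∈ Aⁿ(X × X)_ℚ`
induces `T` on `Hⁱ(X)` and `0` on the other `Hʲ(X)`. [cite: Kleiman1968AlgebraicCycles, §2]
[cite: Jannsen1992Motives, Cor. 1] -/
theorem isHomCorrespondence_single_iff_isAlgebraicOperator {i : ℕ}
    (T : W.obj X i →ₗ[K] W.obj X i) :
    W.IsHomCorrespondence n X (Pi.single i T) ↔ W.IsAlgebraicOperator n n T := by
  classical
  have key : ∀ i' : ℕ, (Pi.single i T : Π j : ℕ, Module.End K (W.obj X j)) i' =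
      PreWeilCohomology.GradedOp.ofLinearMap T i' i' := by
    intro i'
    by_cases hi : i = i'
    · subst hi
      rw [Pi.single_eq_same, PreWeilCohomology.GradedOp.ofLinearMap_apply_same]
    · rw [Pi.single_eq_of_ne' hi, PreWeilCohomology.GradedOp.ofLinearMap_apply_of_ne _ (fun h ↦ hi h.1)]
  constructor
  · rintro ⟨u, hu, hT⟩
    refine ⟨fun c ↦ if hc : n = c then hc ▸ (⟨u, hu⟩ : ↥(W.ratAlgebraicClasses (X ⊗ X) n)) else 0,
      ?_, ?_⟩
    · intro i' j c j' hj hm hc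
      by_cases hcn : n = c
      · subst hcn
        obtain rfl : i' = j := by omega
        dsimp only
        rw [dif_pos rfl, ← key i']
        exact hT i' j' hj
      · have hne : PreWeilCohomology.GradedOp.ofLinearMap T i' j = 0 :=
          PreWeilCohomology.GradedOp.ofLinearMap_apply_of_ne _ (fun h ↦ hcn (by omega))
        dsimp only
        rw [dif_neg hcn, hne, ZeroMemClass.coe_zero]
        exact W.isInducedBy_zero
    · intro i' j hij
      exact PreWeilCohomology.GradedOp.ofLinearMap_apply_of_ne _ (fun h ↦ hij ⟨n, by omega⟩)
  · rintro ⟨u, hu, -⟩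
    refine ⟨(u n : W.obj (X ⊗ X) (2 * n)), (u n).2, fun i' j' h ↦ ?_⟩
    rw [key i']
    exact hu i' i' n j' h (show i' + 2 * n + j' = 2 * (n + n) by omega) (by omega)

/-- The Künneth projector `π^i = Pi.single i 1` (identity on `Hⁱ(X)`, zero elsewhere) lies in
`Bⁿ(X × X)_K` iff `id_{Hⁱ(X)}` is an algebraic operator. [cite: Kleiman1968AlgebraicCycles, §2]
[cite: Jannsen1992Motives, Cor. 1] -/
theorem isHomCorrespondence_single_one_iff (i : ℕ) :
    W.IsHomCorrespondence n X (Pi.single i 1) ↔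
      W.IsAlgebraicOperator n n (LinearMap.id : W.obj X i →ₗ[K] W.obj X i) :=
  W.isHomCorrespondence_single_iff_isAlgebraicOperator (1 : Module.End K (W.obj X i))

/-- **`C(X)` ⇔ every Künneth projector is a homological correspondence with `ℚ`-coefficients**
(`W.StandardConjectureC n X` unfolded through `standardConjectureC_iff` and
`isHomCorrespondence_single_one_iff`). [cite: Kleiman1968AlgebraicCycles, §2]
[cite: Jannsen1992Motives, Cor. 1] -/
theorem standardConjectureC_iff_forall_isHomCorrespondence_single :
    W.StandardConjectureC n X ↔ ∀ i : ℕ, W.IsHomCorrespondence n X (Pi.single i 1) := by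
  rw [standardConjectureC_iff]
  exact forall_congr' fun i ↦ (W.isHomCorrespondence_single_one_iff i).symm

/-- "`Tr_i(f ∘ π^j) = δ_ij Tr_i(f)`": the graded trace of `π^i ∘ f` is `(-1)^i Tr(f_i)` (only the
degree `i` survives; in degrees `> 2n` both sides vanish, `Hⁱ(X) = 0`).
[cite: Jannsen1992Motives, Cor. 1 (proof)] -/
theorem gradedTrace_single_mul (hX : IsSmoothProjective n X) (i : ℕ)
    (f : Π j : ℕ, Module.End K (W.obj X j)) :
    W.gradedTrace n X (Pi.single i 1 * f) = (-1 : K) ^ i * LinearMap.trace K (W.obj X i) (f i) := by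
  classical
  rw [gradedTrace_apply]
  by_cases hi : i < 2 * n + 1
  · rw [Finset.sum_eq_single_of_mem i (Finset.mem_range.mpr hi)]
    · rw [Pi.mul_apply, Pi.single_eq_same, one_mul]
    · intro j _ hji
      rw [Pi.mul_apply, Pi.single_eq_of_ne hji, zero_mul, map_zero, mul_zero]
  · haveI := W.subsingleton_obj hX (i := i) (by omega)
    have hfi : f i = 0 := LinearMap.ext fun x ↦ Subsingleton.elim _ _
    rw [hfi, map_zero, mul_zero]
    refine Finset.sum_eq_zero fun j hj ↦ ?_
    rw [Pi.mul_apply, Pi.single_eq_of_ne (by have := Finset.mem_range.mp hj; omega), zero_mul,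
      map_zero, mul_zero]

end Single

/-! ## Corollary 1 -/

section Corollary1

/-- Under `C(X)`: **a numerically trivial correspondence has `Tr((f_i)^j) = 0` for every degree `i`
and every `j ≥ 1`** ("`Tr_i(f) = 0` for all `i ≥ 0`. The same is true for all powers of `f`": `f^j`
is numerically trivial, and `π^i ∈ B`, so `0 = Σ_l (-1)^l Tr_l(π^i ∘ f^j) = (-1)^i Tr((f_i)^j)`).
[cite: Jannsen1992Motives, Cor. 1 (proof)] -/
theorem trace_pow_eq_zero_of_mem_numericallyTrivial (hX : IsSmoothProjective n X)
    (hC : W.StandardConjectureC n X) {f : W.homCorrAlgebra n X} (hf : f ∈ W.numericallyTrivial n X)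
    (i : ℕ) {j : ℕ} (hj : 0 < j) :
    LinearMap.trace K (W.obj X i) (((f : Π l : ℕ, Module.End K (W.obj X l)) i) ^ j) = 0 := by
  have hπ : W.IsHomCorrespondence n X (Pi.single i 1) :=
    (W.standardConjectureC_iff_forall_isHomCorrespondence_single.mp hC) i
  have hfj : f ^ j ∈ W.numericallyTrivial n X := by
    obtain ⟨j, rfl⟩ := Nat.exists_eq_succ_of_ne_zero hj.ne'
    rw [pow_succ]
    exact (W.numericallyTrivial n X).mul_mem_left _ _ hf
  have h := (W.mem_numericallyTrivial_iff.mp hfj) ⟨Pi.single i 1, hπ.mem_homCorrAlgebra⟩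
  rw [Subalgebra.coe_mul, SubmonoidClass.coe_pow, W.gradedTrace_single_mul hX, Pi.pow_apply] at h
  exact (mul_eq_zero.mp h).resolve_left (pow_ne_zero _ (by norm_num))

/-- Under `C(X)`: **every numerically trivial correspondence is nilpotent** (Jannsen: each `f_i`
"has zero eigenvalues, thus is nilpotent" — here by the trace criterion `tr A^k = 0 (k = 1..dim)
⇒ A nilpotent` in characteristic `0` — and the cycle map `B → ⊕ End Hⁱ(X)` is injective, so `f`
is nilpotent in `B`; a common exponent serves the finitely many degrees `i ≤ 2n`).
[cite: Jannsen1992Motives, Cor. 1 (proof)] [cite: HornJohnson2013, 2.4.P10] -/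
theorem isNilpotent_of_mem_numericallyTrivial (hX : IsSmoothProjective n X)
    (hC : W.StandardConjectureC n X) {f : W.homCorrAlgebra n X} (hf : f ∈ W.numericallyTrivial n X) :
    IsNilpotent f := by
  classical
  -- each component is nilpotent
  have hcomp : ∀ i : ℕ, IsNilpotent ((f : Π l : ℕ, Module.End K (W.obj X l)) i) := by
    intro i
    haveI := W.finite_obj hX i
    set b := Module.finBasis K (W.obj X i)
    rw [← LinearMap.isNilpotent_toMatrix_iff b]
    refine Literature.LinearAlgebra.Matrix.isNilpotent_of_forall_trace_pow_eq_zero _ fun m hm _ ↦ ?_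
    rw [LinearMap.toMatrix_pow, ← LinearMap.trace_eq_matrix_trace K b]
    exact W.trace_pow_eq_zero_of_mem_numericallyTrivial hX hC hf i hm
  -- a common exponent
  choose m hm using hcomp
  refine ⟨∑ i ∈ Finset.range (2 * n + 1), m i, Subtype.ext ?_⟩
  rw [SubmonoidClass.coe_pow, ZeroMemClass.coe_zero]
  funext i
  rw [Pi.pow_apply, Pi.zero_apply]
  by_cases hi : i < 2 * n + 1
  · exact pow_eq_zero_of_le (Finset.single_le_sum (fun j _ ↦ Nat.zero_le (m j))
      (Finset.mem_range.mpr hi)) (hm i)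
  · haveI := W.subsingleton_obj hX (i := i) (by omega)
    exact LinearMap.ext fun x ↦ Subsingleton.elim _ _

/-- **JANNSEN'S COROLLARY 1** (coefficients `K`): if the Künneth projectors of `X` are algebraic
(`C(X)`), then **the numerically trivial correspondences — the kernel of
`S : Bⁿ(X × X)_K → Aⁿ_num(X × X, K)` — form exactly the Jacobson radical of `Bⁿ(X × X)_K`**
(`J' ⊆ Ker S` always, `jacobson_le_numericallyTrivial`; `Ker S` is nil by
`isNilpotent_of_mem_numericallyTrivial`, hence `⊆ J'`). [cite: Jannsen1992Motives, Cor. 1] -/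
theorem numericallyTrivial_eq_jacobson (hX : IsSmoothProjective n X) (hC : W.StandardConjectureC n X) :
    (W.numericallyTrivial n X).asIdeal = Ring.jacobson (W.homCorrAlgebra n X) :=
  W.numericallyTrivial_eq_jacobson_of_forall_isNilpotent hX
    fun _ hf ↦ W.isNilpotent_of_mem_numericallyTrivial hX hC hf

/-- **… and it is a nilpotent ideal** (the Jacobson radical of the artinian ring `Bⁿ(X × X)_K` is
nilpotent). [cite: Jannsen1992Motives, Cor. 1] -/
theorem isNilpotent_numericallyTrivial (hX : IsSmoothProjective n X) (hC : W.StandardConjectureC n X) :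
    IsNilpotent (W.numericallyTrivial n X).asIdeal := by
  haveI := W.isArtinianRing_homCorrAlgebra hX
  rw [W.numericallyTrivial_eq_jacobson hX hC]
  exact IsSemiprimaryRing.isNilpotent

/-- Under `C(X)`, membership in the Jacobson radical of `Bⁿ(X × X)_K` is numerical triviality:
`f ∈ J'` iff `Σ_i (-1)^i Tr_i(g ∘ f) = 0` for all `g ∈ B`. [cite: Jannsen1992Motives, Cor. 1] -/
theorem mem_jacobson_iff_forall_gradedTrace_eq_zero (hX : IsSmoothProjective n X)
    (hC : W.StandardConjectureC n X) (f : W.homCorrAlgebra n X) :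
    f ∈ Ring.jacobson (W.homCorrAlgebra n X) ↔ ∀ g : W.homCorrAlgebra n X,
      W.gradedTrace n X ((g * f : W.homCorrAlgebra n X) : Π i : ℕ, Module.End K (W.obj X i)) = 0 := by
  rw [← W.numericallyTrivial_eq_jacobson hX hC, TwoSidedIdeal.mem_asIdeal, mem_numericallyTrivial_iff]

/-- Under `C(X)`, a correspondence with `Σ_i (-1)^i Tr_i(g ∘ f) = 0` for all `g` is nilpotent, and
conversely every element of a nilpotent two-sided ideal is numerically trivial; in particular
**`f` is numerically trivial iff the two-sided ideal it generates is nil**. Recorded as: `f` is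
numerically trivial iff every `g * f * h` is nilpotent. [cite: Jannsen1992Motives, Cor. 1] -/
theorem mem_numericallyTrivial_iff_forall_isNilpotent (hX : IsSmoothProjective n X)
    (hC : W.StandardConjectureC n X) (f : W.homCorrAlgebra n X) :
    f ∈ W.numericallyTrivial n X ↔ ∀ g h : W.homCorrAlgebra n X, IsNilpotent (g * f * h) := by
  constructor
  · intro hf g h
    exact W.isNilpotent_of_mem_numericallyTrivial hX hC
      ((W.numericallyTrivial n X).mul_mem_right _ _ ((W.numericallyTrivial n X).mul_mem_left _ _ hf))
  · intro hnil
    rw [mem_numericallyTrivial_iff]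
    intro g
    have h1 := hnil g 1
    rw [mul_one] at h1
    exact W.gradedTrace_eq_zero_of_isNilpotent (h1.map (W.homCorrAlgebra n X).val)

/-- **Remark 1 via `B(X)`**: the hypothesis of Corollary 1 holds whenever `B(X)` does (Kleiman 1968
Prop. 2.3: the `πⁱ` are polynomials in `L` and `Λ`; the tree's discharged
`standardConjectureC_of_standardConjectureB_holds`), so for such `X` — e.g. abelian varieties by
Lieberman (`standardConjectureB_abelianVariety_holds`, under hard Lefschetz) — the numerically
trivial correspondences form the (nilpotent) Jacobson radical of `Bⁿ(X × X)_K`.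
[cite: Jannsen1992Motives, Remark 1] [cite: Kleiman1968AlgebraicCycles, Prop. 2.3] -/
theorem numericallyTrivial_eq_jacobson_of_standardConjectureB (hX : IsSmoothProjective n X)
    {η : W.obj X 2} (hη : W.IsHyperplaneClass X η) (hB : W.StandardConjectureB n X η) :
    (W.numericallyTrivial n X).asIdeal = Ring.jacobson (W.homCorrAlgebra n X) :=
  W.numericallyTrivial_eq_jacobson hX (standardConjectureC_of_standardConjectureB_holds hX hη hB)

/-- **Remark 1, abelian varieties** (Lieberman; Kleiman 1968 App. to §2, Thm. 2A11): for an abelian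
variety `A` over `k` and a Weil cohomology theory with hard Lefschetz, the numerically trivial
correspondences of degree `0` on `A × A` form the Jacobson radical of `B^{dim A}(A × A)_K`, a
nilpotent ideal. [cite: Jannsen1992Motives, Remark 1] [cite: Kleiman1968AlgebraicCycles, Appendix to §2, Thm. 2A11] -/
theorem numericallyTrivial_eq_jacobson_abelianVariety (hL : W.HasHardLefschetz) (A : AbelianVariety k)
    {η : W.obj A.X 2} (hη : W.IsHyperplaneClass A.X η) :
    (W.numericallyTrivial A.dim A.X).asIdeal = Ring.jacobson (W.homCorrAlgebra A.dim A.X) := by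
  have hproj : IsProjectiveOver A.X := by
    obtain ⟨e, -, -, -, -⟩ := hη
    exact e.isProjectiveOver
  exact W.numericallyTrivial_eq_jacobson_of_standardConjectureB
    (A.isSmoothProjective_of_isProjectiveOver hproj) hη
    (standardConjectureB_abelianVariety_holds hL A hη)

end Corollary1

end WeilCohomology

end Literature.AlgebraicGeometry.Motives

end
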